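import Summits.PneNP.PneNP.Theses.ConvexRankGates
import Summits.PneNP.PneNP.Theorems.ConvexRankGatesCaptureDefs
import Summits.PneNP.PneNP.Theorems.ConvexRankGatesCaptureConsistencyUnrolls
import Summits.PneNP.PneNP.Theorems.ConvexRankGatesCaptureLandedBundle        -- Stub 2 (p80136) ∧ Baer (p83603), bundled p115956 (rev 7a)
import Summits.PneNP.PneNP.Theorems.ConvexRankGatesCaptureCosetMeetToJoinAbelian
import Summits.PneNP.PneNP.Theorems.ConvexRankGatesCaptureCosetUnsatCoprimePi    -- W1, LANDED p112615 (imported since rev 5a)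
import Summits.PneNP.PneNP.Theorems.ConvexRankGatesCaptureNilpotentReduction    -- W2, LANDED p112880 (imported since rev 6a)
import Summits.PneNP.PneNP.Theorems.ConvexRankGatesCaptureTwoStepCosetCapture   -- Theorem A at gate level, LANDED p113968 (rev 6a)
import Summits.PneNP.PneNP.Theorems.ConvexRankGatesCapturePGroupJuntaReduction   -- W5, LANDED p115211 (rev 6a)
import Literature.Computability.Complexity.ExtMonotoneCircuits
import Literature.Computability.Complexity.CircuitPlug
import Literature.Computability.Complexity.CircuitComposition
import Mathlib.GroupTheory.Nilpotent
import HarnessLib.Audit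

/-!
# Line `csp-spine-meet-to-join` — skeleton rev 7 for crux `ConvexRankGates.Capture` (stmt-PneNP-2659)

Route `route-PneNP-ConvexRankGates`; line card `Cruxes/Capture/Lines/csp-spine-meet-to-join.md`; continuation
lead prover-line-stmt-PneNP-2659-c2-0, 2026-08-16. Crux (by name): `Summit.PneNP.PneNP.Theses.ConvexRankGates.Capture`.

## What changed in rev 5 (lead c2)

Rev 4 (lead gen-1 / lead c1) left seven stubs, of which FOUR are landed theorems (`stub_affineLemmas` p107254,
`stub_quadDivision` p107610, `stub_twoStepStructure` p106731, `stub_cyclicFredholmLanded` = p80136) and a fifth,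
`stub_twoStepCore` (Theorem A: coset CSPs over squares-central exponent-4 groups are ONE `𝔽₂` span program),
is the 40-line assembly of the landed `twoStep_unsat_iff_span_of` (p108774) and `span_program_cktSize` (p108943)
(file `Theorems/ConvexRankGatesCaptureTwoStepCore.lean`, written, waits only for the hub build of its imports).
Rev 5 therefore

* folds Stubs L1, L2, S, C and the rev-4 glue `twoStepCosetCapture` into ONE landed statement
  `TwoStepCosetCaptureLanded`, bundled with the two other landed-but-unbuilt facts the composition consumes
  (`CyclicFredholmLanded` = Stub 2, `BaerLanded` = `isAbelianCosetGate_of_odd_central`, p83603) into the single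
  stub `stub_landedAwaitingBuild` — discharged by `exact ⟨stub_cyclicFredholm, isAbelianCosetGate_of_odd_central,
  twoStepCosetCapture_landed⟩` as soon as the hub has oleans for those modules; NOT delegated;
* RESHAPES the crux-sized `stub_residualCosetCapture` (c1 dossier `Lines/csp-spine-meet-to-join-residual-promote-c1.md`)
  along the one reduction that is a theorem for every finite group, NILPOTENT ⇒ SYLOW: a coset gate over a finite
  nilpotent group is the OR of the coset gates of its Sylow projections (`stub_cosetUnsatCoprimePi`: subgroups of
  a product of groups of pairwise coprime orders split, so UNSAT over the product = UNSAT of some projection —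
  the finite-product form of the landed binary `coset_unsat_coprime_prod` p110030; `stub_nilpotentReduction`:
  Mathlib's `Group.isNilpotent_of_finite_tfae`, transport along `Sylow.directProductOfNormal`) — both PROVABLE NOW;
  the p-group gates so produced are abelian (LANDED Stub 3a), two-step (Theorem A), odd of class 2 (Baer, LANDED)
  or fall into the honest OPEN residual `stub_pGroupResidualCapture` (p-groups that are nonabelian, not
  squares-central-exponent-4, not odd-class-2: class-2 2-groups of exponent ≥ 8 such as `M₁₆`, all p-groups of
  class ≥ 3); the non-nilpotent groups form the second OPEN residual `stub_nonNilpotentCosetCapture` (R-d/R-e of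
  the dossier; Lichter–Pago ICALP 2024 Thm 1.3: no bounded-level ℤ-affine relaxation does the `S₁₈` instances, so
  this stub needs the nonabelian power of PERM gates and is crux-sized — said so);
* keeps `stub_captureModSpine` as what the planner declared it: the crux with the spine adjoined
  (`Capture → CaptureModSpine`, landed p81158).

`Capture_of : landed bundle → twoStepCosetCaptureLanded → nilpotentReduction → centralCertificateZMod → pGroupResidual →
nonNilpotent → captureModSpine → Capture` concludes the crux BY NAME; `sorry` occurs only inside the seven `stub_*`.

Rev 7a (lead c3, 20:05Z): the landed bundle p115956 (`stub_landedAwaitingBuild` = CyclicFredholm p80136 ∧ Baer p83603) is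
finally built on the hub and IMPORTED; three stubs remain: `stub_pGroupResidualCapture` (OPEN), `stub_nonNilpotentCosetCapture`
(OPEN, crux-sized), `stub_captureModSpine` (residual). Conjecture J is refuted IN LEAN:
`Theorems/Capture/Negative/JuntaIncompletenessSetup.lean` (p122127 accepted) + `JuntaIncompleteness.lean` (p122344,
`not_pGroupJuntaCompleteness`).

Rev 7 (lead c3, 2026-08-16 18:40Z): the CONJECTURE `stub_pGroupJuntaCompleteness` of rev 6 is REFUTED (evidence
`Lines/csp-spine-meet-to-join-juntaJ-refuted-c3.md`: an UNSAT coset instance over `D₄` with 10 variables and 8 constraints of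
arity ≤ 3, all selected, carrying a verified `ℤ/8` pseudo-solution — eight chains on the cylinders with identical scope
marginals and mass 1 — so no `(0,t)`, `t ≠ 0`, lies in the closure; the mechanism is a passenger-free transport path, i.e. the
SCOPE-width feature set). Its reduction `stub_pGroupCaptureOfJuntaCompleteness` (LANDED p115211) stays in the tree but leaves
the composition. The p-group residual goes back to the honest OPEN statement of rev 5, `stub_pGroupResidualCapture`
(`PGroupResidualCapture`: residual p-group COSET gates have polynomial extended circuits), with its own exponent `c₄` threaded
through `pGroupCosetCapture` / `Capture_of`. Stubs of rev 7: `stub_landedAwaitingBuild` (landed, hub oleans pending, p115956),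
`stub_pGroupResidualCapture` (OPEN, lead), `stub_nonNilpotentCosetCapture` (OPEN, crux-sized), `stub_captureModSpine` (residual).

Rev 6a (16:50Z): `stub_twoStepCosetCaptureLanded` (p113968), `stub_nilpotentReduction` (p112880) and
`stub_pGroupCaptureOfJuntaCompleteness` (p115211) are LANDED and IMPORTED; four stubs remain: the landed bundle
(CyclicFredholm ∧ Baer, hub oleans still missing), the CONJECTURE `stub_pGroupJuntaCompleteness`, and the two crux-sized
residuals `stub_nonNilpotentCosetCapture`, `stub_captureModSpine`.

Rev 6 (16:30Z): the p-group residual is RESHAPED along the seat's computation: CONJECTURE `stub_pGroupJuntaCompleteness`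
(scope-junta ℤ/|G| span programs are complete for p-groups; > 1500 UNSAT instances over class-2/3/4 2-groups, 0 failures)
+ provable reduction `stub_pGroupCaptureOfJuntaCompleteness` (one ring span program, `ring_span_program_cktSize`);
`stub_centralCertificateZMod` (LANDED p112738) leaves the skeleton (it is an ingredient of the conjecture's intended
proof, not of the composition).

Rev 5a (16:10Z): W1 `stub_cosetUnsatCoprimePi` LANDED (p112615) and is IMPORTED (its sorry is gone); W2 `stub_nilpotentReduction`
LANDED (p112880) and W3 `stub_centralCertificateZMod` (p112738) stay as stubs only until the hub builds their modules; the landed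
bundle is split: `stub_landedAwaitingBuild := CyclicFredholm ∧ Baer` (both landed long ago, hub build pending) and
`stub_twoStepCosetCaptureLanded` (Theorem A at gate level; file `Theorems/ConvexRankGatesCaptureTwoStepCosetCapture.lean`
= `stub_twoStepCore` assembly + wrapper, proposed by this seat).
-/

namespace Summit.PneNP.PneNP.Cruxes.Capture.CspSpineMeetToJoin

set_option linter.unusedVariables false
set_option linter.dupNamespace false

open scoped Matrix
open scoped commutatorElement
open Literature.Computability.Complexity

/-! ## Vocabulary (rev 4, kept): two-step and residual nonabelian COSET gates -/

/-- **Two-step COSET gates**: `IsCosetGate` data over a group with all squares central and `g⁴ = 1`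
(`D₄`, `Q₈`, extraspecial `2^{1+2k}`, `ℤ/4 × …`). Captured by Theorem A (landed pieces, see
`TwoStepCosetCaptureLanded`). -/
def IsTwoStepCosetGate (s : ℕ) (g : GateFn) : Prop :=
  g.1 ≤ s ∧ ∃ (G : Type) (_ : Group G) (_ : Fintype G) (nv : ℕ),
    ((∀ a y : G, a ^ 2 * y = y * a ^ 2) ∧ (∀ a : G, a ^ 4 = 1)) ∧
    Fintype.card G ≤ s ∧ nv ≤ s ∧
    ∃ (r : Fin g.1 → ℕ) (scope : (j : Fin g.1) → Fin (r j) → Fin nv)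
      (H : (j : Fin g.1) → Subgroup (Fin (r j) → G)) (c : (j : Fin g.1) → Fin (r j) → G),
      (∀ j, Fintype.card G ^ r j ≤ s) ∧
      ∀ v : Fin g.1 → Bool, g.2 v = true ↔
        ¬ ∃ h : Fin nv → G, ∀ j, v j = true → (c j)⁻¹ * (fun i => h (scope j i)) ∈ H j

/-- **Residual nonabelian COSET gates** (rev 4): `IsNonabelianCosetGate` data whose group is NOT
squares-central-of-exponent-4. Rev 5 splits it further (nilpotent / non-nilpotent). -/
def IsResidualCosetGate (s : ℕ) (g : GateFn) : Prop :=
  g.1 ≤ s ∧ ∃ (G : Type) (_ : Group G) (_ : Fintype G) (nv : ℕ), (∃ a b : G, a * b ≠ b * a) ∧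
    ¬ ((∀ a y : G, a ^ 2 * y = y * a ^ 2) ∧ (∀ a : G, a ^ 4 = 1)) ∧
    Fintype.card G ≤ s ∧ nv ≤ s ∧
    ∃ (r : Fin g.1 → ℕ) (scope : (j : Fin g.1) → Fin (r j) → Fin nv)
      (H : (j : Fin g.1) → Subgroup (Fin (r j) → G)) (c : (j : Fin g.1) → Fin (r j) → G),
      (∀ j, Fintype.card G ^ r j ≤ s) ∧
      ∀ v : Fin g.1 → Bool, g.2 v = true ↔
        ¬ ∃ h : Fin nv → G, ∀ j, v j = true → (c j)⁻¹ * (fun i => h (scope j i)) ∈ H j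

/-- Every nonabelian COSET gate is two-step or residual (excluded middle on the group property). -/
theorem isNonabelianCosetGate_cases {s : ℕ} {g : GateFn} (hg : IsNonabelianCosetGate s g) :
    IsTwoStepCosetGate s g ∨ IsResidualCosetGate s g := by
  obtain ⟨h1, G, iG, iF, nv, hnc, hG, hnv, r, scope, H, c, hr, hiff⟩ := hg
  by_cases hts : (∀ a y : G, a ^ 2 * y = y * a ^ 2) ∧ (∀ a : G, a ^ 4 = 1)
  · exact Or.inl ⟨h1, G, iG, iF, nv, hts, hG, hnv, r, scope, H, c, hr, hiff⟩
  · exact Or.inr ⟨h1, G, iG, iF, nv, hnc, hts, hG, hnv, r, scope, H, c, hr, hiff⟩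

/-! ## Rev-5 vocabulary: nilpotent / p-group / non-nilpotent COSET gates -/

/-- **Nilpotent COSET gates**: `IsCosetGate` data over a finite NILPOTENT group. -/
def IsNilpotentCosetGate (s : ℕ) (g : GateFn) : Prop :=
  g.1 ≤ s ∧ ∃ (G : Type) (_ : Group G) (_ : Fintype G) (nv : ℕ), Group.IsNilpotent G ∧
    Fintype.card G ≤ s ∧ nv ≤ s ∧
    ∃ (r : Fin g.1 → ℕ) (scope : (j : Fin g.1) → Fin (r j) → Fin nv)
      (H : (j : Fin g.1) → Subgroup (Fin (r j) → G)) (c : (j : Fin g.1) → Fin (r j) → G),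
      (∀ j, Fintype.card G ^ r j ≤ s) ∧
      ∀ v : Fin g.1 → Bool, g.2 v = true ↔
        ¬ ∃ h : Fin nv → G, ∀ j, v j = true → (c j)⁻¹ * (fun i => h (scope j i)) ∈ H j

/-- **p-group COSET gates**: `IsCosetGate` data over a finite `p`-group (some prime `p`). -/
def IsPGroupCosetGate (s : ℕ) (g : GateFn) : Prop :=
  g.1 ≤ s ∧ ∃ (G : Type) (_ : Group G) (_ : Fintype G) (nv : ℕ), (∃ p : ℕ, p.Prime ∧ IsPGroup p G) ∧
    Fintype.card G ≤ s ∧ nv ≤ s ∧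
    ∃ (r : Fin g.1 → ℕ) (scope : (j : Fin g.1) → Fin (r j) → Fin nv)
      (H : (j : Fin g.1) → Subgroup (Fin (r j) → G)) (c : (j : Fin g.1) → Fin (r j) → G),
      (∀ j, Fintype.card G ^ r j ≤ s) ∧
      ∀ v : Fin g.1 → Bool, g.2 v = true ↔
        ¬ ∃ h : Fin nv → G, ∀ j, v j = true → (c j)⁻¹ * (fun i => h (scope j i)) ∈ H j

/-- **Baer hypothesis** (the antecedent of the landed `isAbelianCosetGate_of_odd_central`, verbatim):
`IsCosetGate` data over a group of ODD order with central commutators (class ≤ 2). -/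
def BaerHyp (s : ℕ) (g : GateFn) : Prop :=
  g.1 ≤ s ∧ ∃ (G : Type) (_ : Group G) (_ : Fintype G) (nv : ℕ),
    Odd (Fintype.card G) ∧ (∀ x y z : G, ⁅x, y⁆ * z = z * ⁅x, y⁆) ∧ Fintype.card G ≤ s ∧ nv ≤ s ∧
    ∃ (r : Fin g.1 → ℕ) (scope : (j : Fin g.1) → Fin (r j) → Fin nv)
      (H : (j : Fin g.1) → Subgroup (Fin (r j) → G)) (c : (j : Fin g.1) → Fin (r j) → G),
      (∀ j, Fintype.card G ^ r j ≤ s) ∧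
      ∀ v : Fin g.1 → Bool, g.2 v = true ↔
        ¬ ∃ h : Fin nv → G, ∀ j, v j = true → (c j)⁻¹ * (fun i => h (scope j i)) ∈ H j

/-- **Residual p-group COSET gates** (rev 5, OPEN): coset data over a finite `p`-group that is
nonabelian, NOT squares-central-of-exponent-4 (Theorem A) and NOT odd-of-class-2 (Baer): the class-2
2-groups of exponent `≥ 8` (`M₁₆`, `ℤ/4`-Heisenberg, …) and all `p`-groups of class `≥ 3`. -/
def IsPGroupResidualCosetGate (s : ℕ) (g : GateFn) : Prop :=
  g.1 ≤ s ∧ ∃ (G : Type) (_ : Group G) (_ : Fintype G) (nv : ℕ),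
    ((∃ p : ℕ, p.Prime ∧ IsPGroup p G) ∧ (∃ a b : G, a * b ≠ b * a) ∧
      ¬ ((∀ a y : G, a ^ 2 * y = y * a ^ 2) ∧ (∀ a : G, a ^ 4 = 1)) ∧
      ¬ (Odd (Fintype.card G) ∧ ∀ x y z : G, ⁅x, y⁆ * z = z * ⁅x, y⁆)) ∧
    Fintype.card G ≤ s ∧ nv ≤ s ∧
    ∃ (r : Fin g.1 → ℕ) (scope : (j : Fin g.1) → Fin (r j) → Fin nv)
      (H : (j : Fin g.1) → Subgroup (Fin (r j) → G)) (c : (j : Fin g.1) → Fin (r j) → G),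
      (∀ j, Fintype.card G ^ r j ≤ s) ∧
      ∀ v : Fin g.1 → Bool, g.2 v = true ↔
        ¬ ∃ h : Fin nv → G, ∀ j, v j = true → (c j)⁻¹ * (fun i => h (scope j i)) ∈ H j

/-- **Non-nilpotent COSET gates** (rev 5, OPEN): coset data over a finite group that is NOT nilpotent
(`S₃`, `A₄`, `Dic₃`, `S₄`, `A₅`, Lichter–Pago's `S₁₈` family, …). -/
def IsNonNilpotentCosetGate (s : ℕ) (g : GateFn) : Prop :=
  g.1 ≤ s ∧ ∃ (G : Type) (_ : Group G) (_ : Fintype G) (nv : ℕ), ¬ Group.IsNilpotent G ∧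
    Fintype.card G ≤ s ∧ nv ≤ s ∧
    ∃ (r : Fin g.1 → ℕ) (scope : (j : Fin g.1) → Fin (r j) → Fin nv)
      (H : (j : Fin g.1) → Subgroup (Fin (r j) → G)) (c : (j : Fin g.1) → Fin (r j) → G),
      (∀ j, Fintype.card G ^ r j ≤ s) ∧
      ∀ v : Fin g.1 → Bool, g.2 v = true ↔
        ¬ ∃ h : Fin nv → G, ∀ j, v j = true → (c j)⁻¹ * (fun i => h (scope j i)) ∈ H j

/-- Every residual COSET gate is nilpotent or non-nilpotent (excluded middle). -/
theorem isResidualCosetGate_cases {s : ℕ} {g : GateFn} (hg : IsResidualCosetGate s g) :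
    IsNilpotentCosetGate s g ∨ IsNonNilpotentCosetGate s g := by
  obtain ⟨h1, G, iG, iF, nv, -, -, hG, hnv, r, scope, H, c, hr, hiff⟩ := hg
  by_cases hnil : Group.IsNilpotent G
  · exact Or.inl ⟨h1, G, iG, iF, nv, hnil, hG, hnv, r, scope, H, c, hr, hiff⟩
  · exact Or.inr ⟨h1, G, iG, iF, nv, hnil, hG, hnv, r, scope, H, c, hr, hiff⟩

/-- Every p-group COSET gate is abelian, two-step, Baer (odd, class ≤ 2) or p-residual (excluded middle). -/
theorem isPGroupCosetGate_cases {s : ℕ} {g : GateFn} (hg : IsPGroupCosetGate s g) :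
    IsAbelianCosetGate s g ∨ IsTwoStepCosetGate s g ∨ BaerHyp s g ∨ IsPGroupResidualCosetGate s g := by
  obtain ⟨h1, G, iG, iF, nv, hp, hG, hnv, r, scope, H, c, hr, hiff⟩ := hg
  by_cases hcomm : ∀ a b : G, a * b = b * a
  · exact Or.inl ⟨h1, G, iG, iF, nv, hcomm, hG, hnv, r, scope, H, c, hr, hiff⟩
  by_cases hts : (∀ a y : G, a ^ 2 * y = y * a ^ 2) ∧ (∀ a : G, a ^ 4 = 1)
  · exact Or.inr (Or.inl ⟨h1, G, iG, iF, nv, hts, hG, hnv, r, scope, H, c, hr, hiff⟩)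
  by_cases hbaer : Odd (Fintype.card G) ∧ ∀ x y z : G, ⁅x, y⁆ * z = z * ⁅x, y⁆
  · exact Or.inr (Or.inr (Or.inl ⟨h1, G, iG, iF, nv, hbaer.1, hbaer.2, hG, hnv, r, scope, H, c, hr, hiff⟩))
  · simp only [not_forall] at hcomm
    obtain ⟨a, b, hab⟩ := hcomm
    exact Or.inr (Or.inr (Or.inr
      ⟨h1, G, iG, iF, nv, ⟨hp, ⟨a, b, hab⟩, hts, hbaer⟩, hG, hnv, r, scope, H, c, hr, hiff⟩))

/-! ## The statements consumed by the composition -/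

/-- (2, LANDED p80136, hub build pending) Statement of `stub_cyclicFredholm`
(`Theorems/ConvexRankGatesCaptureCyclicFredholm.lean`). -/
def CyclicFredholmLanded : Prop :=
  ∃ c : ℕ, ∀ (s : ℕ) (g : GateFn), IsLinGate s g →
    ∃ C : Circuit (Fin g.1), C.IsOver (permBasis ((s + 2) ^ c)) ∧ C.size ≤ (s + 2) ^ c ∧
      C.Computes g.2

/-- (Baer, LANDED p83603, hub build pending) Statement of `isAbelianCosetGate_of_odd_central`
(`Theorems/ConvexRankGatesCaptureBaerCoset.lean`), verbatim. -/
def BaerLanded : Prop :=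
  ∀ (s : ℕ) (g : GateFn), (g.1 ≤ s ∧ ∃ (G : Type) (_ : Group G) (_ : Fintype G) (nv : ℕ),
    Odd (Fintype.card G) ∧ (∀ x y z : G, ⁅x, y⁆ * z = z * ⁅x, y⁆) ∧ Fintype.card G ≤ s ∧ nv ≤ s ∧
    ∃ (r : Fin g.1 → ℕ) (scope : (j : Fin g.1) → Fin (r j) → Fin nv)
      (H : (j : Fin g.1) → Subgroup (Fin (r j) → G)) (c : (j : Fin g.1) → Fin (r j) → G),
      (∀ j, Fintype.card G ^ r j ≤ s) ∧
      ∀ v : Fin g.1 → Bool, g.2 v = true ↔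
        ¬ ∃ h : Fin nv → G, ∀ j, v j = true → (c j)⁻¹ * (fun i => h (scope j i)) ∈ H j) →
    IsAbelianCosetGate s g

/-- (Theorem A, pieces LANDED p106731 p107254 p107610 p107616 p107679 p108064 p108774 p108943; assembly
`ConvexRankGatesCaptureTwoStepCore.lean` + gate-level wrapper `ConvexRankGatesCaptureTwoStepCosetCapture.lean`
written, proposals wait for the hub build): every two-step COSET gate of parameter `s` is computed by a
`permBasis ((s+2)^5)`-circuit of size `≤ (s+2)^5` (in fact ONE PERM gate). -/
def TwoStepCosetCaptureLanded : Prop :=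
  ∀ (s : ℕ) (g : GateFn), IsTwoStepCosetGate s g →
    ∃ C : Circuit (Fin g.1), C.IsOver (permBasis ((s + 2) ^ 5)) ∧ C.size ≤ (s + 2) ^ 5 ∧
      C.Computes g.2

/-- (W1, provable) **Coprime splitting over finite products**: over a product `Π p, G p` of finite groups
of pairwise coprime orders, a selected coset system is unsatisfiable iff some coordinate projection of it is
(subgroups of such a product are the product of their projections). Finite-product form of the landed
`coset_unsat_coprime_prod`. -/
def CosetUnsatCoprimePi : Prop :=
  ∀ (κ : Type) [Fintype κ] [DecidableEq κ] (G : κ → Type) [∀ p, Group (G p)] [∀ p, Fintype (G p)],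
    (∀ p q, p ≠ q → (Fintype.card (G p)).Coprime (Fintype.card (G q))) →
    ∀ (nv m : ℕ) (r : Fin m → ℕ) (scope : (j : Fin m) → Fin (r j) → Fin nv)
      (H : (j : Fin m) → Subgroup (Fin (r j) → (∀ p, G p))) (c : (j : Fin m) → Fin (r j) → (∀ p, G p))
      (v : Fin m → Bool),
      (¬ ∃ h : Fin nv → (∀ p, G p), ∀ j, v j = true → (c j)⁻¹ * (fun i => h (scope j i)) ∈ H j) ↔
      ∃ p, ¬ ∃ h : Fin nv → G p, ∀ j, v j = true →
        (fun i => c j i p)⁻¹ * (fun i => h (scope j i)) ∈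
          (H j).map (MonoidHom.compLeft (Pi.evalMonoidHom G p) (Fin (r j)))

/-- (W2, provable) **Nilpotent ⇒ Sylow**: a nilpotent COSET gate of parameter `s` is the OR of `≤ s` p-group
COSET gates of parameter `s` on the same inputs (direct product of the normal Sylow subgroups,
`Group.isNilpotent_of_finite_tfae`, then `CosetUnsatCoprimePi`). -/
def NilpotentReduction : Prop :=
  ∀ (s : ℕ) (g : GateFn), IsNilpotentCosetGate s g →
    ∃ (t : ℕ) (f : Fin t → (Fin g.1 → Bool) → Bool), t ≤ s ∧
      (∀ i, IsPGroupCosetGate s ⟨g.1, f i⟩) ∧ ∀ v : Fin g.1 → Bool, g.2 v = true ↔ ∃ i, f i v = true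

/-- (OPEN) **Residual p-group coset capture**: residual p-group COSET gates are computed by poly-size
circuits over the full extended basis. First layer: class-2 2-groups of exponent `≥ 8` ("Theorem B"). -/
def PGroupResidualCapture : Prop :=
  ∃ c : ℕ, ∀ (s : ℕ) (g : GateFn), IsPGroupResidualCosetGate s g →
    ∃ C : Circuit (Fin g.1), C.IsOver (extGate ((s + 2) ^ c)) ∧ C.size ≤ (s + 2) ^ c ∧
      C.Computes g.2

/-- (OPEN, crux-sized) **Non-nilpotent coset capture**: non-nilpotent COSET gates are computed by
poly-size circuits over the full extended basis. -/
def NonNilpotentCosetCapture : Prop :=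
  ∃ c : ℕ, ∀ (s : ℕ) (g : GateFn), IsNonNilpotentCosetGate s g →
    ∃ C : Circuit (Fin g.1), C.IsOver (extGate ((s + 2) ^ c)) ∧ C.size ≤ (s + 2) ^ c ∧
      C.Computes g.2

/-- (J, CONJECTURE of rev 6 — **REFUTED in rev 7**, lead c3: `Lines/csp-spine-meet-to-join-juntaJ-refuted-c3.md`;
kept as a definition because the landed reduction `stub_pGroupCaptureOfJuntaCompleteness` p115211 mentions it.)
**Scope-junta completeness for p-groups.** For coset-CSP data over a
finite `p`-group `G` (variables `Fin nv`, constraint `j` = "the restriction of `h` to `scope j` lies in `c j · H j`"),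
the SCOPE-JUNTA span program over `ℤ/|G|` is complete: if the selected constraints have no common solution then, for some
`t ≠ 0`, the pair `(0, t)` lies in the additive closure of the union over the selected `j` of the blocks
`R j = {(w, b) | Σ_{(j',α)} w (j',α) · [h ∘ scope j' = α] = b for every h satisfying constraint j}` — all `ℤ/|G|`-affine
relations among the indicator features "the scope-`j'` tuple of `h` equals `α`" that are valid on constraint `j` ALONE.
(Soundness of such certificates is trivial: evaluate at a common solution.) This is the `p`-group case of "ℤ-affine
consistency of scope width solves coset CSPs"; it holds for abelian groups (Fredholm duality, landed Stub 2/3a), for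
odd class 2 (Baer) and for squares-central exponent-4 2-groups (Theorem A, whose `𝔽₂` span program uses only pairs of
coordinates); it FAILS for some non-nilpotent groups (`S₁₈`, Lichter–Pago ICALP 2024 Thm 1.3). EVIDENCE (this seat,
2026-08-16, `work/compute/thmB*.py`, `divtest.py`, kit jobs j018782/j018841): complete on every one of > 1500 UNSAT
instances over `M₁₆`-hull `(ℤ/2)²×_β ℤ/8`, `E3_8`, `ℤ/4`-Heisenberg (class 2, exponent 8), `D₁₆, Q₁₆, SD₁₆` (class 3),
`D₃₂…` (class 4), with a STRICTLY SMALLER feature class (quotient-juntas + one linear coordinate of a central `ℤ/p`);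
0 failures. The missing proof is a division lemma for the layer function of the central certificate (`NOTES.md` §EP). -/
def PGroupJuntaCompleteness : Prop :=
  ∀ (G : Type) [Group G] [Fintype G] [DecidableEq G], (∃ p : ℕ, p.Prime ∧ IsPGroup p G) →
    ∀ (nv m : ℕ) (r : Fin m → ℕ) (scope : (j : Fin m) → Fin (r j) → Fin nv)
      (H : (j : Fin m) → Subgroup (Fin (r j) → G)) (c : (j : Fin m) → Fin (r j) → G) (v : Fin m → Bool),
      (¬ ∃ h : Fin nv → G, ∀ j, v j = true → (c j)⁻¹ * (fun i => h (scope j i)) ∈ H j) →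
      ∃ t : ZMod (Fintype.card G), t ≠ 0 ∧
        ((0 : (Σ j : Fin m, (Fin (r j) → G)) → ZMod (Fintype.card G)), t) ∈
          AddSubgroup.closure (⋃ j ∈ {j : Fin m | v j = true},
            {wb : ((Σ j : Fin m, (Fin (r j) → G)) → ZMod (Fintype.card G)) × ZMod (Fintype.card G) |
              ∀ h : Fin nv → G, (c j)⁻¹ * (fun i => h (scope j i)) ∈ H j →
                ∑ ja : (Σ j' : Fin m, (Fin (r j') → G)),
                  wb.1 ja * (if (fun i => h (scope ja.1 i)) = ja.2 then 1 else 0) = wb.2})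

/-- (R, provable — rev 6) **p-group COSET gates from junta completeness**: under `PGroupJuntaCompleteness` every p-group
COSET gate of parameter `s` is computed by a `permBasis ((s+2)^4)`-circuit with `≤ (s+2)^4` gates: the UNSAT function
is `v ↦ [∃ t ≠ 0, (0,t) ∈ closure (⋃_{v j} R j)]` (completeness = the hypothesis, soundness = evaluation at a solution),
which the landed `ring_span_program_cktSize` (p110419) realises with `2|G|+1` gates once `|G|·(#features + 1) ≤ S`
(`#features = Σ_j |G|^{r_j} ≤ s²`). -/
def PGroupCaptureOfJuntaCompleteness : Prop :=
  ∀ (s : ℕ) (g : GateFn), IsPGroupCosetGate s g →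
    ∃ C : Circuit (Fin g.1), C.IsOver (permBasis ((s + 2) ^ 4)) ∧ C.size ≤ (s + 2) ^ 4 ∧ C.Computes g.2

/-- (4) **Capture modulo the spine** (the declared RESIDUAL, unchanged from rev 1–4): `Capture` verbatim
with the target basis enlarged from `extGate` to `spineGate`. -/
def CaptureModSpine : Prop :=
  ∃ a : ℕ, ∀ (ι : Type) (_ : Fintype ι) (f : (ι → Bool) → Bool), Monotone f →
    ∀ C : Circuit ι, C.IsOver B2 → C.Computes f →
      ∃ C' : Circuit ι, C'.IsOver (spineGate ((C.size + Fintype.card ι + 2) ^ a)) ∧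
        C'.size ≤ (C.size + Fintype.card ι + 2) ^ a ∧ C'.Computes f

/-! ## The stubs of rev 7 (`sorry` only here; every signature written out in full) -/

/-- **Stub P — `PGroupResidualCapture`** (OPEN, rev 7 = the rev-5 residual restored after the refutation of conjecture J;
held by the lead): COSET gates over a finite `p`-group that is nonabelian, not squares-central-of-exponent-4 (Theorem A) and not
odd-of-class-2 (Baer) have polynomial extended circuits. The signature is `PGroupResidualCapture` with
`IsPGroupResidualCosetGate` unfolded. -/
theorem stub_pGroupResidualCapture :
    ∃ c : ℕ, ∀ (s : ℕ) (g : GateFn), (g.1 ≤ s ∧ ∃ (G : Type) (_ : Group G) (_ : Fintype G) (nv : ℕ),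
      ((∃ p : ℕ, p.Prime ∧ IsPGroup p G) ∧ (∃ a b : G, a * b ≠ b * a) ∧
        ¬ ((∀ a y : G, a ^ 2 * y = y * a ^ 2) ∧ (∀ a : G, a ^ 4 = 1)) ∧
        ¬ (Odd (Fintype.card G) ∧ ∀ x y z : G, ⁅x, y⁆ * z = z * ⁅x, y⁆)) ∧
      Fintype.card G ≤ s ∧ nv ≤ s ∧
      ∃ (r : Fin g.1 → ℕ) (scope : (j : Fin g.1) → Fin (r j) → Fin nv)
        (H : (j : Fin g.1) → Subgroup (Fin (r j) → G)) (c : (j : Fin g.1) → Fin (r j) → G),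
        (∀ j, Fintype.card G ^ r j ≤ s) ∧
        ∀ v : Fin g.1 → Bool, g.2 v = true ↔
          ¬ ∃ h : Fin nv → G, ∀ j, v j = true → (c j)⁻¹ * (fun i => h (scope j i)) ∈ H j) →
      ∃ C : Circuit (Fin g.1), C.IsOver (extGate ((s + 2) ^ c)) ∧ C.size ≤ (s + 2) ^ c ∧
        C.Computes g.2 := by
  sorry

/-- **Stub N — `NonNilpotentCosetCapture`** (OPEN, crux-sized: needs the nonabelian power of PERM gates —
Luks-type coset-intersection made monotone; no bounded-level affine relaxation suffices, Lichter–Pago 2024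
Thm 1.3). -/
theorem stub_nonNilpotentCosetCapture :
    ∃ c : ℕ, ∀ (s : ℕ) (g : GateFn), (g.1 ≤ s ∧ ∃ (G : Type) (_ : Group G) (_ : Fintype G) (nv : ℕ),
      ¬ Group.IsNilpotent G ∧ Fintype.card G ≤ s ∧ nv ≤ s ∧
      ∃ (r : Fin g.1 → ℕ) (scope : (j : Fin g.1) → Fin (r j) → Fin nv)
        (H : (j : Fin g.1) → Subgroup (Fin (r j) → G)) (c : (j : Fin g.1) → Fin (r j) → G),
        (∀ j, Fintype.card G ^ r j ≤ s) ∧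
        ∀ v : Fin g.1 → Bool, g.2 v = true ↔
          ¬ ∃ h : Fin nv → G, ∀ j, v j = true → (c j)⁻¹ * (fun i => h (scope j i)) ∈ H j) →
      ∃ C : Circuit (Fin g.1), C.IsOver (extGate ((s + 2) ^ c)) ∧ C.size ≤ (s + 2) ^ c ∧
        C.Computes g.2 := by
  sorry

/-- **Stub 4 — `CaptureModSpine`** (RESIDUAL — declared open, NOT claimed easier than the crux). -/
theorem stub_captureModSpine :
    ∃ a : ℕ, ∀ (ι : Type) (_ : Fintype ι) (f : (ι → Bool) → Bool), Monotone f →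
      ∀ C : Circuit ι, C.IsOver B2 → C.Computes f →
        ∃ C' : Circuit ι, C'.IsOver (spineGate ((C.size + Fintype.card ι + 2) ^ a)) ∧
          C'.size ≤ (C.size + Fintype.card ι + 2) ^ a ∧ C'.Computes f := by
  sorry

/-! ## Name-keyed aliases of the stub statements (hypotheses of the composition) -/
namespace Registered

/-- Alias keyed by the registered stub name (rev 7). -/
abbrev stub_pGroupResidualCapture : Prop := PGroupResidualCapture

/-- Alias keyed by the registered stub name. -/
abbrev stub_nonNilpotentCosetCapture : Prop := NonNilpotentCosetCapture
/-- Alias keyed by the registered stub name. -/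
abbrev stub_captureModSpine : Prop := CaptureModSpine

end Registered

/-- LANDED (p115956, rev 7a): the bundle `CyclicFredholmLanded ∧ BaerLanded` is a theorem of the tree now. -/
example : CyclicFredholmLanded ∧ BaerLanded := stub_landedAwaitingBuild
/-- W1 is LANDED and imported: its statement is a theorem of the tree now. -/
example : CosetUnsatCoprimePi := stub_cosetUnsatCoprimePi
example : Registered.stub_pGroupResidualCapture := stub_pGroupResidualCapture
/-- LANDED and imported (rev 6a): Theorem A at gate level, the Sylow reduction, the junta reduction (the latter is now
idle: its hypothesis `PGroupJuntaCompleteness` is refuted, rev 7). -/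
example : TwoStepCosetCaptureLanded := stub_twoStepCosetCaptureLanded
example : CosetUnsatCoprimePi → NilpotentReduction := stub_nilpotentReduction
example : PGroupJuntaCompleteness → PGroupCaptureOfJuntaCompleteness := stub_pGroupCaptureOfJuntaCompleteness
example : Registered.stub_nonNilpotentCosetCapture := stub_nonNilpotentCosetCapture
example : Registered.stub_captureModSpine := stub_captureModSpine

/-! ## Glue, part 1 (sorry-free): ORs of circuits; p-group and nilpotent COSET gates -/

section OrGlue

variable {B : Set GateFn}

/-- A circuit is a straight-line program realising the function it computes. [folklore] -/
theorem cktSize_of_circuit' {ι : Type*} (C : Circuit ι) (hB : C.IsOver B)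
    {f : (ι → Bool) → Bool} (hf : C.Computes f) : CktSize B (fun x (_ : Unit) => f x) C.size :=
  ⟨C.gates, fun _ => C.output, le_rfl,
    ⟨GateList.wf_gates C, hB, fun _ m hm => C.wf_output m hm,
      fun x _ => (GateList.circuit_eval C x).symm.trans (hf x)⟩⟩

/-- **OR of `t` circuits**: if each `f i` has a `B`-circuit with `≤ N` gates and `B ⊇ {∧₂,∨₂,1,0}`, then
`v ↦ [∃ i, f i v]` has a `B`-circuit with `≤ t·N + t + 1` gates. [folklore] -/
theorem exists_circuit_orFin (hmon : monConst ⊆ B) {n t N : ℕ} (f : Fin t → (Fin n → Bool) → Bool)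
    (hf : ∀ i, ∃ C : Circuit (Fin n), C.IsOver B ∧ C.size ≤ N ∧ C.Computes (f i)) :
    ∃ C : Circuit (Fin n), C.IsOver B ∧ C.size ≤ t * N + (t + 1) ∧
      C.Computes fun v => decide (∃ i, f i v = true) := by
  choose C hCB hCs hCf using hf
  have h1 : CktSize B (fun v (i : Fin t) => f i v) (∑ i : Fin t, N) :=
    CktSize.pi_fin fun i => (cktSize_of_circuit' (C i) (hCB i) (hCf i)).of_le (hCs i)
  have h2 : CktSize B (fun (z : Fin t → Bool) (_ : Unit) => decide (∃ a, z a = true)) (t + 1) :=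
    ((lc_orFin t (_root_.id : Fin t → Fin t)).basis_mono hmon).congr fun z _ => rfl
  have h3 := h1.comp h2
  rw [Finset.sum_const, Finset.card_univ, Fintype.card_fin, smul_eq_mul] at h3
  obtain ⟨C', hB', hs', he'⟩ := h3.toCircuit
  exact ⟨C', hB', hs', fun v => he' v⟩

end OrGlue

/-- A residual p-group COSET gate is in particular a p-group COSET gate. -/
theorem IsPGroupResidualCosetGate.isPGroupCosetGate {s : ℕ} {g : GateFn} (hg : IsPGroupResidualCosetGate s g) :
    IsPGroupCosetGate s g := by
  obtain ⟨h1, G, iG, iF, nv, ⟨hp, -, -, -⟩, hG, hnv, r, scope, H, c, hr, hiff⟩ := hg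
  exact ⟨h1, G, iG, iF, nv, hp, hG, hnv, r, scope, H, c, hr, hiff⟩

/-- **p-group COSET gates** from the landed abelian Stub 3a (`h₃`, exponent `c₃`), Theorem A (two-step, exponent 5),
Baer (odd class 2 ⇒ abelian) and, for the residual p-groups, Stub P (`hR`, exponent `c₄`, OPEN): every p-group COSET
gate of parameter `S` is an `extGate ((S+2)^(c₃+5+c₄))`-circuit with `≤ (S+2)^(c₃+5+c₄)` gates. (The proved cases are
routed through their own theorems so that the composition depends on the open stub only where nothing else is known.) -/
theorem pGroupCosetCapture {c₃ c₄ : ℕ}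
    (h₃ : ∀ (s : ℕ) (g : GateFn), IsAbelianCosetGate s g →
      ∃ C : Circuit (Fin g.1), C.IsOver (permBasis ((s + 2) ^ c₃)) ∧ C.size ≤ (s + 2) ^ c₃ ∧ C.Computes g.2)
    (hT : TwoStepCosetCaptureLanded) (hB : BaerLanded)
    (hR : ∀ (s : ℕ) (g : GateFn), IsPGroupResidualCosetGate s g →
      ∃ C : Circuit (Fin g.1), C.IsOver (extGate ((s + 2) ^ c₄)) ∧ C.size ≤ (s + 2) ^ c₄ ∧ C.Computes g.2)
    (S : ℕ) (g : GateFn) (hg : IsPGroupCosetGate S g) :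
    ∃ C : Circuit (Fin g.1), C.IsOver (extGate ((S + 2) ^ (c₃ + 5 + c₄))) ∧
      C.size ≤ (S + 2) ^ (c₃ + 5 + c₄) ∧ C.Computes g.2 := by
  have h2 : 1 ≤ S + 2 := by omega
  have hpow : ∀ e : ℕ, e ≤ c₃ + 5 + c₄ → (S + 2) ^ e ≤ (S + 2) ^ (c₃ + 5 + c₄) := fun e he =>
    Nat.pow_le_pow_right h2 he
  have hpow1 : ∀ e : ℕ, 1 ≤ (S + 2) ^ e := fun e => Nat.one_le_pow _ _ (by omega)
  rcases isPGroupCosetGate_cases hg with hg' | hg' | hg' | hg'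
  · obtain ⟨A, hAB, hAs, hAc⟩ := h₃ S g hg'
    exact ⟨A, hAB.mono ((permBasis_subset_extGate (hpow1 c₃)).trans (extGate_mono (hpow c₃ (by omega)))),
      hAs.trans (hpow c₃ (by omega)), hAc⟩
  · obtain ⟨A, hAB, hAs, hAc⟩ := hT S g hg'
    exact ⟨A, hAB.mono ((permBasis_subset_extGate (hpow1 5)).trans (extGate_mono (hpow 5 (by omega)))),
      hAs.trans (hpow 5 (by omega)), hAc⟩
  · obtain ⟨A, hAB, hAs, hAc⟩ := h₃ S g (hB S g hg')
    exact ⟨A, hAB.mono ((permBasis_subset_extGate (hpow1 c₃)).trans (extGate_mono (hpow c₃ (by omega)))),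
      hAs.trans (hpow c₃ (by omega)), hAc⟩
  · obtain ⟨A, hAB, hAs, hAc⟩ := hR S g hg'
    exact ⟨A, hAB.mono (extGate_mono (hpow c₄ (by omega))), hAs.trans (hpow c₄ (by omega)), hAc⟩

/-- **Nilpotent COSET gates**: by `NilpotentReduction` a nilpotent COSET gate of parameter `S` is an OR of
`≤ S` p-group COSET gates, each an `extGate ((S+2)^e)`-circuit with `≤ (S+2)^e` gates; the OR costs
`≤ S·(S+2)^e + S + 1 ≤ (S+2)^(e+2)` gates. -/
theorem nilpotentCosetCapture {e : ℕ} (hN : NilpotentReduction)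
    (hP : ∀ (s : ℕ) (g : GateFn), IsPGroupCosetGate s g →
      ∃ C : Circuit (Fin g.1), C.IsOver (extGate ((s + 2) ^ e)) ∧ C.size ≤ (s + 2) ^ e ∧ C.Computes g.2)
    (S : ℕ) (g : GateFn) (hg : IsNilpotentCosetGate S g) :
    ∃ C : Circuit (Fin g.1), C.IsOver (extGate ((S + 2) ^ (e + 2))) ∧
      C.size ≤ (S + 2) ^ (e + 2) ∧ C.Computes g.2 := by
  obtain ⟨t, f, ht, hf, hiff⟩ := hN S g hg
  have h2 : 1 ≤ S + 2 := by omega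
  have hpow1 : ∀ e : ℕ, 1 ≤ (S + 2) ^ e := fun e => Nat.one_le_pow _ _ (by omega)
  have hmon : monConst ⊆ extGate ((S + 2) ^ e) := monConst_subset_extGate (hpow1 e)
  obtain ⟨C, hCB, hCs, hCf⟩ := exists_circuit_orFin hmon f fun i => hP S ⟨g.1, f i⟩ (hf i)
  have hle : (S + 2) ^ e ≤ (S + 2) ^ (e + 2) := Nat.pow_le_pow_right h2 (by omega)
  refine ⟨C, hCB.mono (extGate_mono hle), hCs.trans ?_, fun v => ?_⟩
  · calc t * (S + 2) ^ e + (t + 1) ≤ S * (S + 2) ^ e + (S + 1) := by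
          have := Nat.mul_le_mul_right ((S + 2) ^ e) ht
          omega
      _ ≤ (S + 2) * (S + 2) ^ e + (S + 2) * (S + 2) ^ e := by
          have h1 : S * (S + 2) ^ e ≤ (S + 2) * (S + 2) ^ e := Nat.mul_le_mul_right _ (by omega)
          have h3 : S + 1 ≤ (S + 2) * (S + 2) ^ e := by
            calc S + 1 ≤ S + 2 := by omega
              _ = (S + 2) * 1 := (mul_one _).symm
              _ ≤ (S + 2) * (S + 2) ^ e := Nat.mul_le_mul_left _ (hpow1 e)
          omega
      _ = 2 * (S + 2) ^ (e + 1) := by ring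
      _ ≤ (S + 2) * (S + 2) ^ (e + 1) := Nat.mul_le_mul_right _ (by omega)
      _ = (S + 2) ^ (e + 2) := by ring
  · rw [hCf v, Bool.eq_iff_iff, hiff v, decide_eq_true_iff]

/-! ## Glue, part 2 (sorry-free): the residual keeps `Monotone f`; `Capture → CaptureModSpine` -/

/-- **The residual keeps the hypothesis `Monotone f`**: dropping it makes `CaptureModSpine` false. -/
theorem captureModSpine_false_without_monotone :
    ¬ ∃ a : ℕ, ∀ (ι : Type) (_ : Fintype ι) (f : (ι → Bool) → Bool),
      ∀ C : Circuit ι, C.IsOver B2 → C.Computes f →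
        ∃ C' : Circuit ι, C'.IsOver (spineGate ((C.size + Fintype.card ι + 2) ^ a)) ∧
          C'.size ≤ (C.size + Fintype.card ι + 2) ^ a ∧ C'.Computes f := by
  rintro ⟨a, h⟩
  obtain ⟨C, hCB, -, hCev⟩ := (cktSize_not (ι := Fin 1) (0 : Fin 1)).toCircuit
  obtain ⟨C', hC'over, -, hC'comp⟩ := h (Fin 1) inferInstance (fun x => !(x 0)) C hCB
    (fun x => hCev x)
  have hmono : Monotone (fun x : Fin 1 → Bool => !(x 0)) := by
    intro x y hxy
    rw [← hC'comp x, ← hC'comp y]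
    exact monotone_eval_of_isOver_spineGate C' hC'over hxy
  exact not_monotone_bnot_apply (0 : Fin 1) hmono

/-- **The residual is WEAKER than the crux**: `Capture → CaptureModSpine`. -/
theorem capture_imp_captureModSpine
    (hCap : Summit.PneNP.PneNP.Theses.ConvexRankGates.Capture) : CaptureModSpine := by
  obtain ⟨a, hcap⟩ := hCap
  refine ⟨a, fun ι _ f hf C hB2 hcomp => ?_⟩
  obtain ⟨C', hover, hsize, hcomp'⟩ := hcap ι inferInstance f hf C hB2 hcomp
  refine ⟨C', fun g hg => extGate_subset_spineGate _ (mem_extGate_iff.2 ?_), hsize, hcomp'⟩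
  exact hover g hg

/-! ## Glue, part 3 (sorry-free): gate-by-gate basis simulation via `GateList.plug` (rev 4, unchanged) -/

section GateSim

open GateList

variable {ι : Type*}

/-- Relocating an old wire: inputs stay, old gate `m` now lives at `τ m`. -/
def relWire (τ : ℕ → ι ⊕ ℕ) : ι ⊕ ℕ → ι ⊕ ℕ
  | .inl i => .inl i
  | .inr m => τ m

/-- Simulation invariant after translating the prefix `gs`: the new program `P` is well formed,
over `B`, has `≤ M·|gs|` gates, and old gate `m` is carried by the wire `τ m`. -/
structure SimInv (B : Set GateFn) (M : ℕ) (gs : List (Gate ι)) (P : List (Gate ι))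
    (τ : ℕ → ι ⊕ ℕ) : Prop where
  wf : WF P
  isOver : ∀ g ∈ P, g.fn ∈ B
  len : P.length ≤ M * gs.length
  carries : ∃ d, ∀ m, m < gs.length →
    Carries P (τ m) (fun x => wireOf x (vals gs x) (.inr m)) d

/-- Under the invariant every valid old wire is carried by its relocation. -/
theorem SimInv.carries_relWire {B : Set GateFn} {M : ℕ} {gs P : List (Gate ι)} {τ : ℕ → ι ⊕ ℕ}
    (hI : SimInv B M gs P τ) : ∃ d, ∀ w : ι ⊕ ℕ, OutOK gs.length w →
      Carries P (relWire τ w) (fun x => wireOf x (vals gs x) w) d := by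
  obtain ⟨d, hd⟩ := hI.carries
  refine ⟨d, fun w hw => ?_⟩
  cases w with
  | inl i => exact (carries_input P i).mono (Nat.zero_le d)
  | inr m => exact hd m (hw m rfl)

/-- One simulation step: plug the simulating circuit of the next gate behind the program. -/
theorem SimInv.snoc {B : Set GateFn} {M : ℕ} {gs P : List (Gate ι)} {τ : ℕ → ι ⊕ ℕ}
    (hI : SimInv B M gs P τ) (g : Gate ι) (hg : GateOK gs.length g) (A : Circuit (Fin g.arity))
    (hAB : A.IsOver B) (hAs : A.size ≤ M) (hAev : ∀ y, A.eval y = g.op y) :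
    ∃ P' τ', SimInv B M (gs ++ [g]) P' τ' := by
  obtain ⟨d, hd⟩ := hI.carries_relWire
  set ρ : Fin g.arity → ι ⊕ ℕ := fun a => relWire τ (g.args a) with hρ
  have hρc : ∀ a, Carries P (ρ a) (fun x => wireOf x (vals gs x) (g.args a)) d :=
    fun a => hd (g.args a) fun m hm => hg a m hm
  have hρok : WiresOK P.length ρ := fun a => (hρc a).outOK
  refine ⟨(plug P ρ A).1, fun m => if m = gs.length then (plug P ρ A).2 else τ m,
    ⟨wf_plug hI.wf hρok A, fn_mem_plug hI.isOver ρ hAB, ?_, ⟨A.acDepth + d, fun m hm => ?_⟩⟩⟩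
  · rw [length_plug, List.length_append, List.length_singleton, Nat.mul_succ]
    exact Nat.add_le_add hI.len hAs
  · rw [List.length_append, List.length_singleton] at hm
    by_cases hmL : m = gs.length
    · subst hmL
      rw [if_pos rfl]
      refine (carries_plug A hρc).congr fun x => ?_
      rw [hAev, wireOf_inr, vals_append_singleton, List.getD_eq_getElem?_getD,
        List.getElem?_append_right (by simp), length_vals, Nat.sub_self]
      simp
    · rw [if_neg hmL]
      have hm' : m < gs.length := by omega
      have hc : Carries P (τ m) (fun x => wireOf x (vals gs x) (.inr m)) d :=
        hd (.inr m) fun m' hm'' => by cases hm''; exact hm'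
      refine ((hc.plug ρ A).mono (Nat.le_add_left d A.acDepth)).congr fun x => ?_
      exact (wireOf_append_left x gs [g] (o := .inr m) fun m' hm'' => by
        cases hm''; exact hm').symm

/-- **Gate-by-gate basis simulation.** If every gate function of the basis `B'` is computed by a
`B`-circuit with at most `M` gates, then every `B'`-circuit `C` is simulated by a `B`-circuit with
at most `M · |C|` gates (Vollmer 1999, §1.2: plug the simulating circuit of each gate behind the
translated prefix, `GateList.plug`). [folklore] -/
theorem exists_circuit_of_gateSim {B B' : Set GateFn} {M : ℕ}
    (hsim : ∀ g : GateFn, g ∈ B' →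
      ∃ A : Circuit (Fin g.1), A.IsOver B ∧ A.size ≤ M ∧ A.Computes g.2)
    (C : Circuit ι) (hC : C.IsOver B') :
    ∃ C' : Circuit ι, C'.IsOver B ∧ C'.size ≤ M * C.size ∧ ∀ x, C'.eval x = C.eval x := by
  have key : ∀ gs : List (Gate ι), WF gs → (∀ g ∈ gs, g.fn ∈ B') →
      ∃ P τ, SimInv B M gs P τ := by
    intro gs
    induction gs using List.reverseRecOn with
    | nil =>
      intro _ _
      exact ⟨[], fun _ => .inr 0,
        ⟨WF.nil, fun g hg => by simp at hg, by simp, ⟨0, fun m hm => by simp at hm⟩⟩⟩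
    | append_singleton gs g ih =>
      intro hwf hB'
      obtain ⟨P, τ, hI⟩ :=
        ih hwf.of_append_left fun g' hg' => hB' g' (List.mem_append_left _ hg')
      obtain ⟨A, hAB, hAs, hAev⟩ := hsim g.fn (hB' g (by simp))
      exact hI.snoc g hwf.getLast A hAB hAs hAev
  obtain ⟨P, τ, hI⟩ := key C.gates (wf_gates C) hC
  obtain ⟨d, hd⟩ := hI.carries_relWire
  have hout : Carries P (relWire τ C.output) (fun x => wireOf x (vals C.gates x) C.output) d :=
    hd C.output C.wf_output
  refine ⟨toCircuit P (relWire τ C.output) hI.wf hout.outOK,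
    isOver_toCircuit hI.wf hout.outOK hI.isOver, ?_, fun x => ?_⟩
  · rw [size_toCircuit]
    exact hI.len
  · rw [eval_toCircuit hI.wf hout, circuit_eval]

end GateSim

/-! ## The composition: `Capture` from the landed Stubs 1, 3a, the landed bundle and the five rev-5 stubs -/

/-- **`Capture` from the stubs** (concludes the crux BY NAME). Every spine gate of parameter `S` is an
`extGate ((S+2)^c)`-circuit with `≤ (S+2)^c` gates: extended gates are their own one-gate circuits; LC gates
by the LANDED `stub_consistencyUnrolls` (`c₁`); LIN gates by the LANDED `stub_cyclicFredholm` (`c₂`); abelian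
COSET gates by the LANDED `stub_cosetMeetToJoinAbelian` (`c₃`); two-step COSET gates by Theorem A (`5`);
nilpotent residual COSET gates by the Sylow reduction + p-group capture (`c₃+5+c₄+2`, Stub P supplies `c₄`);
non-nilpotent ones by Stub N (`c₆`); `c = c₁+c₂+c₃+5+c₄+c₆+2`. Stub 4 turns the `B₂`-circuit of a monotone `f` into a
spine circuit of size `≤ S = (t+n+2)^a`; the gate-by-gate simulation gives an extended circuit with
`≤ (S+2)^c · S ≤ (S+2)^{c+1} ≤ (t+n+2)^{(a+2)(c+1)}` gates over `extGate ((S+2)^c) ⊆ extGate ((t+n+2)^{(a+2)(c+1)})`. -/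
theorem Capture_of (hP : Registered.stub_pGroupResidualCapture)
    (h₆ : Registered.stub_nonNilpotentCosetCapture) (h₄ : Registered.stub_captureModSpine) :
    Summit.PneNP.PneNP.Theses.ConvexRankGates.Capture := by
  obtain ⟨c₁, h₁⟩ := stub_consistencyUnrolls
  obtain ⟨⟨c₂, h₂⟩, hBaer⟩ := stub_landedAwaitingBuild
  have hTwo : TwoStepCosetCaptureLanded := stub_twoStepCosetCaptureLanded
  obtain ⟨c₃, h₃⟩ := stub_cosetMeetToJoinAbelian
  obtain ⟨c₄, hR'⟩ := hP
  obtain ⟨c₆, h₆'⟩ := h₆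
  have hN : NilpotentReduction := stub_nilpotentReduction stub_cosetUnsatCoprimePi
  have hPg := pGroupCosetCapture h₃ hTwo hBaer hR'
  have hNil := nilpotentCosetCapture hN hPg
  obtain ⟨a, h₄⟩ := h₄
  set c : ℕ := c₁ + c₂ + c₃ + 5 + c₄ + c₆ + 2 with hc
  -- every spine gate of parameter `S` is an extended circuit of parameter and size `(S+2)^c`
  have hsim : ∀ S : ℕ, ∀ g : GateFn, g ∈ spineGate S → ∃ A : Circuit (Fin g.1),
      A.IsOver (extGate ((S + 2) ^ c)) ∧ A.size ≤ (S + 2) ^ c ∧ A.Computes g.2 := by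
    intro S g hg
    have h2 : 1 ≤ S + 2 := by omega
    have hS1 : 1 ≤ (S + 2) ^ c := Nat.one_le_pow _ _ (by omega)
    have hSc : S ≤ (S + 2) ^ c :=
      (Nat.le_add_right S 2).trans (by simpa using Nat.pow_le_pow_right h2 (by omega : 1 ≤ c))
    have hpow : ∀ e : ℕ, e ≤ c → (S + 2) ^ e ≤ (S + 2) ^ c := fun e he =>
      Nat.pow_le_pow_right h2 he
    have hpow1 : ∀ e : ℕ, 1 ≤ (S + 2) ^ e := fun e => Nat.one_le_pow _ _ (by omega)
    rcases hg with hg | hg | hg | hg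
    · obtain ⟨A, hAB, hAs, hAev⟩ := (CktSize.gate (ι := Fin g.1) g hg id).toCircuit
      exact ⟨A, hAB.mono (extGate_mono hSc), hAs.trans hS1, fun y => hAev y⟩
    · obtain ⟨A, hAB, hAs, hAc⟩ := h₁ S g hg
      exact ⟨A, hAB.mono (monConst_subset_extGate hS1), hAs.trans (hpow c₁ (by omega)), hAc⟩
    · obtain ⟨A, hAB, hAs, hAc⟩ := h₂ S g hg
      exact ⟨A, hAB.mono ((permBasis_subset_extGate (hpow1 c₂)).trans
        (extGate_mono (hpow c₂ (by omega)))), hAs.trans (hpow c₂ (by omega)), hAc⟩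
    · rcases isCosetGate_cases hg with hg | hg
      · obtain ⟨A, hAB, hAs, hAc⟩ := h₃ S g hg
        exact ⟨A, hAB.mono ((permBasis_subset_extGate (hpow1 c₃)).trans
          (extGate_mono (hpow c₃ (by omega)))), hAs.trans (hpow c₃ (by omega)), hAc⟩
      · rcases isNonabelianCosetGate_cases hg with hg | hg
        · obtain ⟨A, hAB, hAs, hAc⟩ := hTwo S g hg
          exact ⟨A, hAB.mono ((permBasis_subset_extGate (hpow1 5)).trans
            (extGate_mono (hpow 5 (by omega)))), hAs.trans (hpow 5 (by omega)), hAc⟩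
        · rcases isResidualCosetGate_cases hg with hg | hg
          · obtain ⟨A, hAB, hAs, hAc⟩ := hNil S g hg
            exact ⟨A, hAB.mono (extGate_mono (hpow (c₃ + 5 + c₄ + 2) (by omega))),
              hAs.trans (hpow (c₃ + 5 + c₄ + 2) (by omega)), hAc⟩
          · obtain ⟨A, hAB, hAs, hAc⟩ := h₆' S g hg
            exact ⟨A, hAB.mono (extGate_mono (hpow c₆ (by omega))),
              hAs.trans (hpow c₆ (by omega)), hAc⟩
  -- the crux, with exponent `(a+2)(c+1)`
  unfold Summit.PneNP.PneNP.Theses.ConvexRankGates.Capture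
  dsimp only
  refine ⟨(a + 2) * (c + 1), fun ι _ f hf C hB2 hcomp => ?_⟩
  obtain ⟨C', hC'over, hC'size, hC'comp⟩ := h₄ ι inferInstance f hf C hB2 hcomp
  set N : ℕ := C.size + Fintype.card ι + 2 with hN
  set S : ℕ := N ^ a with hS
  obtain ⟨C'', hover'', hsize'', hev''⟩ := exists_circuit_of_gateSim (hsim S) C' hC'over
  -- arithmetic: `(S+2)^(c+1) ≤ N^((a+2)(c+1))`
  have hN2 : 2 ≤ N := by omega
  have h4 : 2 ^ 2 ≤ N ^ 2 := Nat.pow_le_pow_left hN2 2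
  have hS2 : S + 2 ≤ N ^ (a + 2) :=
    calc S + 2 ≤ 2 ^ 2 * S := by
          have hS1 : 1 ≤ S := Nat.one_le_pow _ _ (by omega)
          omega
      _ ≤ N ^ 2 * S := Nat.mul_le_mul_right _ h4
      _ = N ^ (a + 2) := by rw [hS]; ring
  have hbound : (S + 2) ^ (c + 1) ≤ N ^ ((a + 2) * (c + 1)) := by
    rw [pow_mul]
    exact Nat.pow_le_pow_left hS2 _
  have hbound' : (S + 2) ^ c ≤ N ^ ((a + 2) * (c + 1)) :=
    (Nat.pow_le_pow_right (by omega) (Nat.le_succ c)).trans hbound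
  refine ⟨C'', fun g hg => mem_extGate_iff.1 (extGate_mono hbound' (hover'' g hg)), ?_,
    fun x => (hev'' x).trans (hC'comp x)⟩
  calc C''.size ≤ (S + 2) ^ c * C'.size := hsize''
    _ ≤ (S + 2) ^ c * (S + 2) := Nat.mul_le_mul_left _ (hC'size.trans (Nat.le_add_right S 2))
    _ = (S + 2) ^ (c + 1) := (pow_succ _ _).symm
    _ ≤ N ^ ((a + 2) * (c + 1)) := hbound

/-- Wiring check: the registered stubs feed `Capture_of` as stated (sorries only via the stubs). -/
example : Summit.PneNP.PneNP.Theses.ConvexRankGates.Capture :=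
  Capture_of stub_pGroupResidualCapture stub_nonNilpotentCosetCapture stub_captureModSpine

end Summit.PneNP.PneNP.Cruxes.Capture.CspSpineMeetToJoin
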